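import Summits.BirchSwinnertonDyer.BirchSwinnertonDyer.Theorems.ByReductionTypeAtTwoAdditiveReducibleRestDescentRoad
import HarnessLib

/-!
# K4 crux `AdditiveRankZeroAtTwo` (item 19098), children C3″ `AdditivePotGoodLowerHalfAtTwo` (22617) and C2″
# `AdditivePotGoodReducibleRestAtTwo` (22616): BOTH halves of `BSD₂` at a census row from DESCENT COUNTS ALONE —
# a STRICT torsion step `#Ш[2^j] > #Ш[2^{j-1}]` is an element of order `2^j` (lower half, via `(ord x)² ∣ #Ш`), a
# FLAT step `#Ш[2^{k+1}] = #Ш[2^k]` bounds every element (upper half); with `a = ord₂ #Ш_an = 2k` the three counts at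
# levels `2^{k-1}, 2^k, 2^{k+1}` («up, then flat») give `BSD(E,2)` at the row, Euler-system-free

Cell `bsd-2adic`, seat `bsd-2adic-k4-w2` GEN 0; `--supports stmt-BirchSwinnertonDyer-22617 --as helper` (serves 22616 equally);
sequel of p650635 / p651341 / p652085. HONEST FRAMING: conditional theorems (published inputs BY NAME + per-row descent-count
SLOTS `#Sel^(n)(W) = 2^s`, `#W(ℚ)[n] = 2^t` at three levels — OBJECTS computed outside the kernel by `n`-descents); closes
nothing at the `∀`-level; nothing booked; BSD is not proved by any of this.

WHAT THIS FILE DOES.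
* §1 (any abelian group): `#A[p^{j-1}] < #A[p^j]` (finite) gives an element of order exactly `p^j`
  (`exists_addOrderOf_eq_pow_of_natCard_torsionBy_lt`) — the LOWER twin of p652085's flat step.
* §2 (`Ш(E/K)`, rank `0`): the strict step READ OFF two descent counts (`s_j - t_j > s_{j-1} - t_{j-1}`, via the tree's
  PROVED X.4.2 count) gives `x ∈ Ш(E/K)` with `ord x = p^j`, hence `p^{2j} ∣ #Ш` by p650635 (Cassels–Tate).
* §3 (over `ℚ`, analytic rank `0`): `missingLowerBoundAt_of_descentCounts_strict` (lower half from the strict step at level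
  `j` with `ord_p #Ш_an ≤ 2j`); `missingPPartAt_of_descentCounts` and `bsdp_of_descentCounts` (BOTH halves, hence Miller's
  `BSD(E,p)`, from the first descent `s ≤ t + 2`, a strict step at level `k` and a flat step at level `k + 1`, `ord_p #Ш_an = 2k`).
* §4 keyed to the children: `addPotGoodLower_two_of_descentCounts_at_member` + the `∀`-closure
  `additivePotGoodLowerHalfAtTwo_of_descentCountCertificates` (C3″ BY NAME from CT + Cassels + GZK + modularity + ONE pair
  of descent counts per class), and `addPotGood_bsdp_two_of_descentCounts` (BSD₂ at an additive potentially-good rank-`0` row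
  from three descent counts: for the census shape `#Ш_an = 16` — `#Ш[2] = 4 < #Ш[4] = 16 = #Ш[8]`).

CENSUS POINTER (evidence on items 22617 / 22616, `k4w2/gen0/CENSUS-22617-22616-k4w2-GEN0.md`): levels `2` and `4` are
two-engine on all 1 480 classes (eng-2: `dim Ш[2] = 2`, CT split `Ш[2] ⊆ 2Ш[4]` ⇒ `#Ш[4] = 16`), so the strict step at
`j = 2` — hence C3″ per class — is engine-certified on the 1 413 classes with `a = 4`; level `8` (the flat step, C2″'s rest and
the upper half in general) and the `a ≥ 6` classes (67) are not computed in the cell.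

References: [SilvermanAEC2009] Thm. X.4.2, Thm. X.4.14; [Wall1963QuadraticFormsFiniteGroups] Lemma 7; [Cassels1965ArithmeticVIII] /
[MilneADT2006] Thm. I.7.3; [Miller2011LMS] §1, Def. 1.1; [GrossZagier1986], [Kolyvagin1990].
-/

set_option autoImplicit false
set_option linter.dupNamespace false

noncomputable section

open scoped Classical AddSubgroup

/-! ## §1 A strict torsion step is an element of order exactly `p^j` -/

namespace Literature.GroupTheory.FiniteAbelian

universe u

/-- **Strict step ⇒ exact order**: if `#A[p^{j-1}] < #A[p^j]` (the larger one finite) then some `x ∈ A` has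
`ord x = p^j` — any element of `A[p^j] ∖ A[p^{j-1}]` (its order divides `p^j` but not `p^{j-1}`). [folklore] -/
theorem exists_addOrderOf_eq_pow_of_natCard_torsionBy_lt {A : Type u} [AddCommGroup A] (p : ℕ) [hp : Fact p.Prime]
    (j : ℕ) [Finite (AddSubgroup.torsionBy A ((p ^ (j + 1) : ℕ) : ℤ))]
    (hlt : Nat.card (AddSubgroup.torsionBy A ((p ^ j : ℕ) : ℤ)) <
      Nat.card (AddSubgroup.torsionBy A ((p ^ (j + 1) : ℕ) : ℤ))) :
    ∃ x : A, addOrderOf x = p ^ (j + 1) := by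
  have hle : AddSubgroup.torsionBy A ((p ^ j : ℕ) : ℤ) ≤ AddSubgroup.torsionBy A ((p ^ (j + 1) : ℕ) : ℤ) := by
    intro x hx
    refine AddSubgroup.torsionBy.nsmul_iff.mpr ?_
    rw [pow_succ, mul_nsmul, AddSubgroup.torsionBy.nsmul_iff.mp hx, nsmul_zero]
  have hne : AddSubgroup.torsionBy A ((p ^ j : ℕ) : ℤ) ≠ AddSubgroup.torsionBy A ((p ^ (j + 1) : ℕ) : ℤ) := by
    intro h; rw [h] at hlt; exact lt_irrefl _ hlt
  obtain ⟨x, hxj1, hxj⟩ := SetLike.exists_of_lt (lt_of_le_of_ne hle hne)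
  refine ⟨x, ?_⟩
  have h1 : p ^ (j + 1) • x = 0 := AddSubgroup.torsionBy.nsmul_iff.mp hxj1
  have h2 : ¬ p ^ j • x = 0 := fun h ↦ hxj (AddSubgroup.torsionBy.nsmul_iff.mpr h)
  obtain ⟨i, hi, hord⟩ := (Nat.dvd_prime_pow hp.out).mp (addOrderOf_dvd_of_nsmul_eq_zero h1)
  rw [hord]
  rcases Nat.lt_or_ge i (j + 1) with hij | hij
  · exfalso
    apply h2
    have hdvd : addOrderOf x ∣ p ^ j := by
      rw [hord]; exact pow_dvd_pow p (Nat.lt_succ_iff.mp hij)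
    exact addOrderOf_dvd_iff_nsmul_eq_zero.mp hdvd
  · exact congrArg _ (le_antisymm hi hij)

end Literature.GroupTheory.FiniteAbelian

/-! ## §2 `Ш(E/K)`: a strict step read off two descent counts is an element of order `p^j`, so `p^{2j} ∣ #Ш` -/

namespace WeierstrassCurve

open Literature.NumberTheory.EllipticCurves Literature.GroupTheory.FiniteAbelian

universe u

variable {K : Type u} [Field K] [NumberField K]

/-- **An element of order `p^{j+1}` in `Ш(E/K)` from two descent counts** (rank `0`, finite `Ш`): if
`#Sel^(p^j) = p^{s₁}`, `#E(K)[p^j] = p^{t₁}`, `#Sel^(p^{j+1}) = p^{s₂}`, `#E(K)[p^{j+1}] = p^{t₂}` with a STRICT step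
`s₁ + t₂ < s₂ + t₁` (i.e. `#Ш[p^j] < #Ш[p^{j+1}]`, X.4.2 count), then some `x ∈ Ш(E/K)` has `ord x = p^{j+1}`.
[cite: SilvermanAEC2009, Thm. X.4.2] -/
theorem exists_addOrderOf_eq_pow_of_selmer_counts (W : WeierstrassCurve K) [W.IsElliptic] [Finite W.sha] (p : ℕ)
    [hp : Fact p.Prime] (hr : W.mordellWeilRank = 0) (j : ℕ) {s₁ t₁ s₂ t₂ : ℕ}
    (hs₁ : Nat.card (W.selmerGroup (p ^ j)) = p ^ s₁) (ht₁ : Nat.card (W.toAffine.Point[((p ^ j : ℕ) : ℤ)]) = p ^ t₁)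
    (hs₂ : Nat.card (W.selmerGroup (p ^ (j + 1))) = p ^ s₂)
    (ht₂ : Nat.card (W.toAffine.Point[((p ^ (j + 1) : ℕ) : ℤ)]) = p ^ t₂) (hstrict : s₁ + t₂ < s₂ + t₁) :
    ∃ x : W.sha, addOrderOf x = p ^ (j + 1) := by
  have hk0 : p ^ j ≠ 0 := pow_ne_zero j hp.out.ne_zero
  have hk1 : p ^ (j + 1) ≠ 0 := pow_ne_zero (j + 1) hp.out.ne_zero
  obtain ⟨h₁, ht₁s⟩ := natCard_sha_torsionBy_eq_of_selmer_count W p hr hk0 hs₁ ht₁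
  obtain ⟨h₂, ht₂s⟩ := natCard_sha_torsionBy_eq_of_selmer_count W p hr hk1 hs₂ ht₂
  refine exists_addOrderOf_eq_pow_of_natCard_torsionBy_lt p j ?_
  rw [h₁, h₂]
  exact Nat.pow_lt_pow_right hp.out.one_lt (by omega)

/-- **`p^{2(j+1)} ∣ #Ш(E/K)` from a strict descent step** (finite `Ш`, rank `0`): the element of order `p^{j+1}` of
`exists_addOrderOf_eq_pow_of_selmer_counts`, squared by Cassels–Tate (p650635
`pow_two_mul_dvd_shaOrder_of_orderWitness_of_casselsTate`). Conditional on the pairing fact `hCT` and the two count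
slots. [cite: SilvermanAEC2009, Thm. X.4.2 and Thm. X.4.14] -/
theorem pow_dvd_shaOrder_of_selmer_counts_strict (hCT : exists_casselsTate_pairing (K := K))
    (W : WeierstrassCurve K) [W.IsElliptic] [Finite W.sha] (p : ℕ) [hp : Fact p.Prime] (hr : W.mordellWeilRank = 0)
    (j : ℕ) {s₁ t₁ s₂ t₂ : ℕ} (hs₁ : Nat.card (W.selmerGroup (p ^ j)) = p ^ s₁)
    (ht₁ : Nat.card (W.toAffine.Point[((p ^ j : ℕ) : ℤ)]) = p ^ t₁)
    (hs₂ : Nat.card (W.selmerGroup (p ^ (j + 1))) = p ^ s₂)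
    (ht₂ : Nat.card (W.toAffine.Point[((p ^ (j + 1) : ℕ) : ℤ)]) = p ^ t₂) (hstrict : s₁ + t₂ < s₂ + t₁) :
    p ^ (2 * (j + 1)) ∣ W.shaOrder := by
  obtain ⟨x, hx⟩ := exists_addOrderOf_eq_pow_of_selmer_counts W p hr j hs₁ ht₁ hs₂ ht₂ hstrict
  exact pow_two_mul_dvd_shaOrder_of_orderWitness_of_casselsTate hCT W p hx

end WeierstrassCurve

/-! ## §3 Over `ℚ`, analytic rank `0`: the lower half from a strict step; both halves from «up, then flat» -/

namespace Summit.BirchSwinnertonDyer.BirchSwinnertonDyer.Theorems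

open WeierstrassCurve Literature.NumberTheory.EllipticCurves
  Literature.NumberTheory.EllipticCurves.Rank1Residual
  Literature.NumberTheory.EllipticCurves.Rank1Residual.Typed
  Literature.GroupTheory.FiniteAbelian
  Summit.BirchSwinnertonDyer.Rank1Residual.Additive

section Pair

variable (W : WeierstrassCurve ℚ) [W.IsElliptic] (p : ℕ) [hp : Fact p.Prime]

/-- **The LOWER half at a rank-`0` pair from a strict descent step**, Euler-system-free: analytic rank `0` (GZK `hGZK`:
rank `0`, `Ш` finite); counts at levels `p^j`, `p^{j+1}` with `s₁ + t₂ < s₂ + t₁`; `#Ш_an(W) = q` with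
`ord_p q ≤ 2(j+1)`. Then `ord_p #Ш_an(W) ≤ ord_p #Ш(W)`. Conditional on `hCT`, `hGZK` and the two count slots.
[cite: SilvermanAEC2009, Thm. X.4.2 and Thm. X.4.14] [cite: Miller2011LMS, Def. 1.1] -/
theorem missingLowerBoundAt_of_descentCounts_strict (hCT : exists_casselsTate_pairing (K := ℚ))
    (hGZK : rank_eq_analyticRank_of_analyticRank_le_one) (hr : W.analyticRank = 0) (j : ℕ) {s₁ t₁ s₂ t₂ : ℕ}
    (hs₁ : Nat.card (W.selmerGroup (p ^ j)) = p ^ s₁) (ht₁ : Nat.card (W.toAffine.Point[((p ^ j : ℕ) : ℤ)]) = p ^ t₁)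
    (hs₂ : Nat.card (W.selmerGroup (p ^ (j + 1))) = p ^ s₂)
    (ht₂ : Nat.card (W.toAffine.Point[((p ^ (j + 1) : ℕ) : ℤ)]) = p ^ t₂) (hstrict : s₁ + t₂ < s₂ + t₁)
    {q : ℚ} (hq : shaAn W = (q : ℂ)) (hv : padicValRat p q ≤ ((2 * (j + 1) : ℕ) : ℤ)) :
    MissingLowerBoundAt W p := by
  have hr1 : W.analyticRank ≤ 1 := by rw [hr]; exact zero_le_one
  haveI : Finite W.sha := (hGZK W hr1).2
  have hrk : W.mordellWeilRank = 0 := by rw [(hGZK W hr1).1, hr]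
  obtain ⟨x, hx⟩ := exists_addOrderOf_eq_pow_of_selmer_counts W p hrk j hs₁ (by convert ht₁ using 4; convert Iff.rfl)
    hs₂ (by convert ht₂ using 4; convert Iff.rfl) hstrict
  exact missingLowerBoundAt_of_orderWitness_pow_of_casselsTate W p hCT hGZK hr1 hq hx hv

/-- **BOTH halves at a rank-`0` pair from three descent levels («up, then flat»)**, Euler-system-free: analytic rank `0`;
first descent `#Sel^(p) = p^s`, `#E(ℚ)[p] = p^t`, `s ≤ t + 2`; counts at levels `p^k`, `p^{k+1}`, `p^{k+2}` with a
STRICT step `k → k+1` and a FLAT step `k+1 → k+2`; `#Ш_an(W) = q` with `ord_p q = 2(k+1)`. Then `MissingPPartAt W p`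
(`ord_p #Ш_an = ord_p #Ш`). Conditional on `hCT`, `hGZK` and the count slots.
[cite: SilvermanAEC2009, Thm. X.4.2 and Thm. X.4.14] [cite: Miller2011LMS, Def. 1.1] -/
theorem missingPPartAt_of_descentCounts (hCT : exists_casselsTate_pairing (K := ℚ))
    (hGZK : rank_eq_analyticRank_of_analyticRank_le_one) (hr : W.analyticRank = 0) {s t : ℕ}
    (hs : Nat.card (W.selmerGroup p) = p ^ s) (ht : Nat.card (W.toAffine.Point[(p : ℤ)]) = p ^ t) (hst : s ≤ t + 2)
    (k : ℕ) {s₁ t₁ s₂ t₂ s₃ t₃ : ℕ}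
    (hs₁ : Nat.card (W.selmerGroup (p ^ k)) = p ^ s₁) (ht₁ : Nat.card (W.toAffine.Point[((p ^ k : ℕ) : ℤ)]) = p ^ t₁)
    (hs₂ : Nat.card (W.selmerGroup (p ^ (k + 1))) = p ^ s₂)
    (ht₂ : Nat.card (W.toAffine.Point[((p ^ (k + 1) : ℕ) : ℤ)]) = p ^ t₂)
    (hs₃ : Nat.card (W.selmerGroup (p ^ (k + 1 + 1))) = p ^ s₃)
    (ht₃ : Nat.card (W.toAffine.Point[((p ^ (k + 1 + 1) : ℕ) : ℤ)]) = p ^ t₃)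
    (hstrict : s₁ + t₂ < s₂ + t₁) (hflat : s₃ + t₂ = s₂ + t₃)
    {q : ℚ} (hq : shaAn W = (q : ℂ)) (hv : padicValRat p q = ((2 * (k + 1) : ℕ) : ℤ)) : MissingPPartAt W p :=
  missingPPartAt_of_lower_of_upper W p
    (missingLowerBoundAt_of_descentCounts_strict W p hCT hGZK hr k hs₁ ht₁ hs₂ ht₂ hstrict hq hv.le)
    (missingUpperBoundAt_of_descentCounts W p hCT hGZK hr hs ht hst (k + 1) hs₂ ht₂ hs₃ ht₃ hflat hq hv.ge)

/-- **Miller's `BSD(E,p)` at a rank-`0` curve from three descent levels** («up, then flat»; GZK `hGZK` supplies the rank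
part and the finiteness of `Ш`). Euler-system-free; conditional on `hCT`, `hGZK` and the count slots.
[cite: SilvermanAEC2009, Thm. X.4.2 and Thm. X.4.14] [cite: Miller2011LMS, §1 and Def. 1.1] -/
theorem bsdp_of_descentCounts (hCT : exists_casselsTate_pairing (K := ℚ))
    (hGZK : rank_eq_analyticRank_of_analyticRank_le_one) (hr : W.analyticRank = 0) {s t : ℕ}
    (hs : Nat.card (W.selmerGroup p) = p ^ s) (ht : Nat.card (W.toAffine.Point[(p : ℤ)]) = p ^ t) (hst : s ≤ t + 2)
    (k : ℕ) {s₁ t₁ s₂ t₂ s₃ t₃ : ℕ}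
    (hs₁ : Nat.card (W.selmerGroup (p ^ k)) = p ^ s₁) (ht₁ : Nat.card (W.toAffine.Point[((p ^ k : ℕ) : ℤ)]) = p ^ t₁)
    (hs₂ : Nat.card (W.selmerGroup (p ^ (k + 1))) = p ^ s₂)
    (ht₂ : Nat.card (W.toAffine.Point[((p ^ (k + 1) : ℕ) : ℤ)]) = p ^ t₂)
    (hs₃ : Nat.card (W.selmerGroup (p ^ (k + 1 + 1))) = p ^ s₃)
    (ht₃ : Nat.card (W.toAffine.Point[((p ^ (k + 1 + 1) : ℕ) : ℤ)]) = p ^ t₃)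
    (hstrict : s₁ + t₂ < s₂ + t₁) (hflat : s₃ + t₂ = s₂ + t₃)
    {q : ℚ} (hq : shaAn W = (q : ℂ)) (hv : padicValRat p q = ((2 * (k + 1) : ℕ) : ℤ)) : BSDp W p :=
  bsdp_of_missingPPartAt W p hGZK (by rw [hr]; exact zero_le_one)
    (missingPPartAt_of_descentCounts W p hCT hGZK hr hs ht hst k hs₁ ht₁ hs₂ ht₂ hs₃ ht₃ hstrict hflat hq hv)

end Pair

end Summit.BirchSwinnertonDyer.BirchSwinnertonDyer.Theorems

/-! ## §4 Keyed to the children C3″ / C2″ -/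

namespace Summit.BirchSwinnertonDyer.BirchSwinnertonDyer.Theorems.AddKatoTwo

open WeierstrassCurve Literature.NumberTheory.EllipticCurves
  Literature.NumberTheory.EllipticCurves.Rank1Residual
  Literature.NumberTheory.EllipticCurves.Rank1Residual.Typed
  Summit.BirchSwinnertonDyer.BirchSwinnertonDyer.Theorems
  Summit.BirchSwinnertonDyer.Rank1Residual.Additive
  Summit.BirchSwinnertonDyer.BirchSwinnertonDyer.Theses.ByReductionTypeAtTwo

/-- **C3″ at `W` from a strict descent step at ANY globally minimal member `W'`** (binders of the child verbatim, carried):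
counts at levels `2^j`, `2^{j+1}` at `W'` with `s₁ + t₂ < s₂ + t₁` and `ord₂ #Ш_an(W') ≤ 2(j+1)` give
`MissingLowerBoundAt W 2` (§3 at `W'`, then Cassels' transport). For the 1 413 census classes with `a = 4`: `j = 1`,
i.e. `#Ш[2] < #Ш[4]` — engine-certified on all of them (eng-2 two-engine CT split). Conditional on `hCT`, Cassels
`hCassels`, `hGZK`, modularity `hmod` and the two count slots.
[cite: SilvermanAEC2009, Thm. X.4.2 and Thm. X.4.14] [cite: MilneADT2006, Thm. I.7.3] [cite: Miller2011LMS, Def. 1.1] -/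
theorem addPotGoodLower_two_of_descentCounts_at_member (hCT : exists_casselsTate_pairing (K := ℚ))
    (hCassels : bsdRHS_eq_of_isIsogenous) (hGZK : rank_eq_analyticRank_of_analyticRank_le_one)
    (hmod : hasEntireLFunction_rat) (W : WeierstrassCurve ℚ) [W.IsElliptic] [W.IsGloballyMinimal]
    (_hcm : ¬ W.HasCM) (hr : W.analyticRank = 0) (_hadd : Addv W 2) (_hj : 0 ≤ padicValRat 2 W.j)
    (W' : WeierstrassCurve ℚ) [W'.IsElliptic] [W'.IsGloballyMinimal] (hiso : IsIsogenous W W') (j : ℕ)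
    {s₁ t₁ s₂ t₂ : ℕ} (hs₁ : Nat.card (W'.selmerGroup (2 ^ j)) = 2 ^ s₁)
    (ht₁ : Nat.card (W'.toAffine.Point[((2 ^ j : ℕ) : ℤ)]) = 2 ^ t₁)
    (hs₂ : Nat.card (W'.selmerGroup (2 ^ (j + 1))) = 2 ^ s₂)
    (ht₂ : Nat.card (W'.toAffine.Point[((2 ^ (j + 1) : ℕ) : ℤ)]) = 2 ^ t₂) (hstrict : s₁ + t₂ < s₂ + t₁)
    {q' : ℚ} (hq' : shaAn W' = (q' : ℂ)) (hv' : padicValRat 2 q' ≤ ((2 * (j + 1) : ℕ) : ℤ)) :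
    MissingLowerBoundAt W 2 := by
  haveI : Fact (Nat.Prime 2) := ⟨Nat.prime_two⟩
  have hr1 : W.analyticRank ≤ 1 := by rw [hr]; exact zero_le_one
  have hr' : W'.analyticRank = 0 := by rw [← analyticRank_eq_of_isIsogenous' hiso, hr]
  have hr1' : W'.analyticRank ≤ 1 := by rw [hr']; exact zero_le_one
  exact TwistComparison.missingLowerBoundAt_of_isIsogenous W' W 2 hCassels hGZK hmod hiso.symm_of_charZero hr1'
    (missingLowerBoundAt_of_descentCounts_strict W' 2 hCT hGZK hr' j hs₁ ht₁ hs₂ ht₂ hstrict hq' hv')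

/-- **C3″ `AdditivePotGoodLowerHalfAtTwo` from Cassels–Tate, Cassels, GZK, modularity and ONE STRICT DESCENT STEP PER CLASS.**
`hcert`: on every row of the child, SOME globally minimal member `W'` of its class carries counts at levels `2^j`, `2^{j+1}`
with a strict step and `ord₂ #Ш_an(W') ≤ 2(j+1)`. Class-wide `hcert` is NOT a theorem of print and the tree cannot compute
it; the item is NOT closed. Conditional on the four published facts and the slots.
[cite: SilvermanAEC2009, Thm. X.4.2 and Thm. X.4.14] [cite: MilneADT2006, Thm. I.7.3] [cite: Miller2011LMS, Def. 1.1] -/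
theorem additivePotGoodLowerHalfAtTwo_of_descentCountCertificates (hCT : exists_casselsTate_pairing (K := ℚ))
    (hCassels : bsdRHS_eq_of_isIsogenous) (hGZK : rank_eq_analyticRank_of_analyticRank_le_one)
    (hmod : hasEntireLFunction_rat)
    (hcert : ∀ (W : WeierstrassCurve ℚ) [W.IsElliptic] [W.IsGloballyMinimal], ¬ W.HasCM → W.analyticRank = 0 →
      Addv W 2 → 0 ≤ padicValRat 2 W.j →
      ∃ (W' : WeierstrassCurve ℚ) (_ : W'.IsElliptic) (_ : W'.IsGloballyMinimal), IsIsogenous W W' ∧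
        ∃ (j s₁ t₁ s₂ t₂ : ℕ) (q' : ℚ),
          Nat.card (W'.selmerGroup (2 ^ j)) = 2 ^ s₁ ∧ Nat.card (W'.toAffine.Point[((2 ^ j : ℕ) : ℤ)]) = 2 ^ t₁ ∧
          Nat.card (W'.selmerGroup (2 ^ (j + 1))) = 2 ^ s₂ ∧
          Nat.card (W'.toAffine.Point[((2 ^ (j + 1) : ℕ) : ℤ)]) = 2 ^ t₂ ∧ s₁ + t₂ < s₂ + t₁ ∧
          shaAn W' = (q' : ℂ) ∧ padicValRat 2 q' ≤ ((2 * (j + 1) : ℕ) : ℤ)) :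
    AdditivePotGoodLowerHalfAtTwo := by
  intro W _ _ hcm hr hadd hj
  obtain ⟨W', hW'e, hW'm, hiso, j, s₁, t₁, s₂, t₂, q', hs₁, ht₁, hs₂, ht₂, hstrict, hq', hv'⟩ := hcert W hcm hr hadd hj
  haveI := hW'e
  haveI := hW'm
  exact addPotGoodLower_two_of_descentCounts_at_member hCT hCassels hGZK hmod W hcm hr hadd hj W' hiso j hs₁ ht₁ hs₂ ht₂
    hstrict hq' hv'

/-- **`BSD(E,2)` at an additive potentially-good rank-`0` curve from THREE DESCENT LEVELS** («up, then flat»), Euler-system-free: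
`W` globally minimal, non-CM, analytic rank `0`, additive and potentially good at `2` (reduction binders carried, not used);
first descent `s ≤ t + 2`; counts at `2^k`, `2^{k+1}`, `2^{k+2}` with a strict then a flat step; `ord₂ #Ш_an(W) = 2(k+1)`.
For the census shape `#Ш_an = 16`: `k = 1`, «`#Ш[2] = 4 < #Ш[4] = 16 = #Ш[8]`» — levels `2`, `4` two-engine on all 1 480
classes, level `8` not computed. Both children C3″ and C2″ (and Kato's member road) are bypassed AT THE ROW; class-wide
nothing changes. Conditional on `hCT`, `hGZK` and the count slots.
[cite: SilvermanAEC2009, Thm. X.4.2 and Thm. X.4.14] [cite: Miller2011LMS, §1 and Def. 1.1] -/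
theorem addPotGood_bsdp_two_of_descentCounts (hCT : exists_casselsTate_pairing (K := ℚ))
    (hGZK : rank_eq_analyticRank_of_analyticRank_le_one) (W : WeierstrassCurve ℚ) [W.IsElliptic] [W.IsGloballyMinimal]
    (_hcm : ¬ W.HasCM) (hr : W.analyticRank = 0) (_hadd : Addv W 2) (_hj : 0 ≤ padicValRat 2 W.j) {s t : ℕ}
    (hs : Nat.card (W.selmerGroup 2) = 2 ^ s) (ht : Nat.card (W.toAffine.Point[(2 : ℤ)]) = 2 ^ t) (hst : s ≤ t + 2)
    (k : ℕ) {s₁ t₁ s₂ t₂ s₃ t₃ : ℕ}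
    (hs₁ : Nat.card (W.selmerGroup (2 ^ k)) = 2 ^ s₁) (ht₁ : Nat.card (W.toAffine.Point[((2 ^ k : ℕ) : ℤ)]) = 2 ^ t₁)
    (hs₂ : Nat.card (W.selmerGroup (2 ^ (k + 1))) = 2 ^ s₂)
    (ht₂ : Nat.card (W.toAffine.Point[((2 ^ (k + 1) : ℕ) : ℤ)]) = 2 ^ t₂)
    (hs₃ : Nat.card (W.selmerGroup (2 ^ (k + 1 + 1))) = 2 ^ s₃)
    (ht₃ : Nat.card (W.toAffine.Point[((2 ^ (k + 1 + 1) : ℕ) : ℤ)]) = 2 ^ t₃)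
    (hstrict : s₁ + t₂ < s₂ + t₁) (hflat : s₃ + t₂ = s₂ + t₃)
    {q : ℚ} (hq : shaAn W = (q : ℂ)) (hv : padicValRat 2 q = ((2 * (k + 1) : ℕ) : ℤ)) : BSDp W 2 := by
  haveI : Fact (Nat.Prime 2) := ⟨Nat.prime_two⟩
  exact bsdp_of_descentCounts W 2 hCT hGZK hr hs (by simpa only [Nat.cast_ofNat] using ht) hst k hs₁ ht₁ hs₂ ht₂ hs₃ ht₃
    hstrict hflat hq hv

end Summit.BirchSwinnertonDyer.BirchSwinnertonDyer.Theorems.AddKatoTwo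

end
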